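import Mathlib
import Summits.ValiantsHypothesis.ValiantsHypothesis.Theorems.KPlusLogSqLawWeakLiftingTowerGraftSectorRootSums
import Summits.ValiantsHypothesis.ValiantsHypothesis.Theorems.LacunarySymmetroidMatrixDescartesRolleSchurStep

/-!
# Tower graft line — THE SPIKE POTENTIAL (residual of the graft, spike sums, the abstract one-crossing step)

Mechanism file for the line `Cruxes/WeakLifting/Lines/tower_graft.lean` (crux `WeakLifting` = stmt-ValiantsHypothesis-19561,
memo `tower_graft-S5.md` §3 T1 «log-slope localisation»); second machinery file after `…TowerGraftSectorRootSums.lean`,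
consumed by `…TowerGraftRealEvents.lean` (one-sided in-sector REAL events cost two crossings each).  NO stub is claimed.

CONTENT (def-free).
§1 The Rolle–Schur RESIDUAL of the two-digit graft `h = A + X^D·E` against the digit `E` with twist `D` is graft-free:
   `X(h′E − hE′) − D·hE = X(A′E − AE′) − D·AE` (`residual_graft_eq` — the far digit is killed by its own exponent, via the tree's
   `RolleSchur.X_mul_derivative_X_pow`), and off the roots of `A·E` it equals `A·E·Φ` with the LOG-SLOPE POTENTIAL
   `Φ(t) = t·A′/A − D − t·E′/E` (`residual_eval_eq`).
§2 SPIKE SUMS `g(t) = Σ_{a ∈ l} t/(t − a)` over a multiset of positive reals: the complex root sums of `…SectorRootSums` over real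
   points are these (`rootSum_ofReal_re`, `rootSumDeriv_ofReal_re`); spikes above `t` pull down (`spikeSum_nonpos_of_lt`), the
   derivative `Σ −a/(t − a)²` is `≤ 0` (`spikeDeriv_nonpos`), the spikes below `t` dominate (`spikeSum_le_filter`), and the
   CURVATURE BOUND `g₊²/k − g₊ ≤ Σ a·t/(t − a)²` (`spike_curvature`: `a t/(t−a)² = x² − x` for `x = t/(t−a)`, Cauchy–Schwarz
   over the `k` spikes below `t`).
§3 The ABSTRACT ONE-CROSSING STEP (`potential_no_two_zeros`): on `[x, y]`, if `g` is antitone, `Φ′ < 0` wherever `g ≥ L`, and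
   `g(y) ≥ L`, then `Φ` cannot vanish at both `x` and `y` (`antitoneOn_of_deriv_nonpos` + `strictAntiOn_of_deriv_neg`).
§4 The TRANSITION-ZONE ARITHMETIC (`transition_zone_arith`): `D·s ≥ 4n`, `1 ≤ k ≤ n`, `g₊ ≥ D − n/s`, `g₊²/k − g₊ ≤ R`
   ⟹ `n/s² < R` — the spike curvature beats the off-sector drift under LINEAR steepness (AM–GM: `D²s² ≥ 16n²`).
HONEST FRAMING: elementary real analysis; nothing on S4/S4b/S5, TowerB, `WeakLifting`, Conjecture B, `MatrixDescartes` (18050) or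
`VP ≠ VNP`.  Seat: prover val-sym-lift-p1 g20, `--supports stmt-ValiantsHypothesis-19561`.
-/

-- `Summit.ValiantsHypothesis.ValiantsHypothesis.…` repeats a component by the D-0017 layout
-- (single-conjunct summit), which the `dupNamespace` linter flags; the name is mandated.
set_option linter.dupNamespace false

namespace Summit.ValiantsHypothesis.ValiantsHypothesis.Theorems.KPlusLogSqLaw.TowerGraft

open Polynomial
open scoped BigOperators Polynomial

/-! ## §1 The residual of the graft and the log-slope potential -/

section Residual

/-- **the far digit is killed by its own exponent**: for `h = A + X^D·E`,
`X·(h′E − hE′) − D·hE = X·(A′E − AE′) − D·AE`. [folklore] -/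
theorem residual_graft_eq (A E : ℝ[X]) (D : ℕ) :
    X * (derivative (A + X ^ D * E) * E - (A + X ^ D * E) * derivative E) - C (D : ℝ) * ((A + X ^ D * E) * E) =
      X * (derivative A * E - A * derivative E) - C (D : ℝ) * (A * E) := by
  have hXd := LacunarySymmetroidMatrixDescartes.RolleSchur.X_mul_derivative_X_pow (k := D)
  simp only [derivative_add, derivative_mul]
  linear_combination (E * E) * hXd

/-- off the roots of `A·E` the residual is `A·E·Φ` with `Φ(t) = t·A′/A − D − t·E′/E`. [folklore] -/
theorem residual_eval_eq (A E : ℝ[X]) (D : ℕ) {t : ℝ} (hAt : A.eval t ≠ 0) (hEt : E.eval t ≠ 0) :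
    (X * (derivative A * E - A * derivative E) - C (D : ℝ) * (A * E)).eval t =
      A.eval t * E.eval t *
        (t * (A.derivative.eval t / A.eval t) - D - t * (E.derivative.eval t / E.eval t)) := by
  simp only [eval_sub, eval_mul, eval_X, eval_C]
  field_simp
  ring

end Residual

/-! ## §2 Spike sums `g(t) = Σ_a t/(t − a)` over real points -/

section Spikes

/-- a complex root sum over real points is the real spike sum. [folklore] -/
theorem rootSum_ofReal_re (l : Multiset ℝ) (t : ℝ) :
    (((l.map fun a : ℝ => (a : ℂ)).map fun z => (t : ℂ) / ((t : ℂ) - z)).sum).re =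
      (l.map fun a => t / (t - a)).sum := by
  have hmap : ((l.map fun a : ℝ => (a : ℂ)).map fun z => (t : ℂ) / ((t : ℂ) - z)) =
      (l.map fun a => t / (t - a)).map Complex.ofRealHom := by
    rw [Multiset.map_map, Multiset.map_map]
    refine Multiset.map_congr rfl fun a _ => ?_
    simp only [Function.comp_apply, Complex.ofRealHom_eq_coe]
    push_cast
    rfl
  rw [hmap, ← map_multiset_sum, Complex.ofRealHom_eq_coe, Complex.ofReal_re]

/-- … and the same for the derivative sum. [folklore] -/
theorem rootSumDeriv_ofReal_re (l : Multiset ℝ) (t : ℝ) :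
    (((l.map fun a : ℝ => (a : ℂ)).map fun z => -z / ((t : ℂ) - z) ^ 2).sum).re =
      (l.map fun a => -a / (t - a) ^ 2).sum := by
  have hmap : ((l.map fun a : ℝ => (a : ℂ)).map fun z => -z / ((t : ℂ) - z) ^ 2) =
      (l.map fun a => -a / (t - a) ^ 2).map Complex.ofRealHom := by
    rw [Multiset.map_map, Multiset.map_map]
    refine Multiset.map_congr rfl fun a _ => ?_
    simp only [Function.comp_apply, Complex.ofRealHom_eq_coe]
    push_cast
    rfl
  rw [hmap, ← map_multiset_sum, Complex.ofRealHom_eq_coe, Complex.ofReal_re]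

/-- spikes above `t` pull down: if every `a ∈ l` exceeds `t > 0` then `Σ t/(t − a) ≤ 0`. [folklore] -/
theorem spikeSum_nonpos_of_lt (l : Multiset ℝ) {t : ℝ} (ht : 0 < t) (hl : ∀ a ∈ l, t < a) :
    (l.map fun a => t / (t - a)).sum ≤ 0 := by
  have h := Multiset.sum_map_le_sum_map (fun a => t / (t - a)) (fun _ => (0 : ℝ)) (s := l) fun a ha =>
    (div_neg_of_pos_of_neg ht (sub_neg.mpr (hl a ha))).le
  simpa using h

/-- the derivative of the spike sum is non-positive (`−a/(t − a)² ≤ 0` for `a > 0`). [folklore] -/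
theorem spikeDeriv_nonpos (l : Multiset ℝ) (t : ℝ) (hl : ∀ a ∈ l, 0 < a) :
    (l.map fun a => -a / (t - a) ^ 2).sum ≤ 0 := by
  have h := Multiset.sum_map_le_sum_map (fun a => -a / (t - a) ^ 2) (fun _ => (0 : ℝ)) (s := l) fun a ha =>
    div_nonpos_of_nonpos_of_nonneg (neg_nonpos.mpr (hl a ha).le) (sq_nonneg _)
  simpa using h

/-- the spikes BELOW `t` dominate the spike sum: `Σ_{a ∈ l} t/(t − a) ≤ Σ_{a < t} t/(t − a)`. [folklore] -/
theorem spikeSum_le_filter (l : Multiset ℝ) {t : ℝ} (ht : 0 < t) (hlt : ∀ a ∈ l, a ≠ t) :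
    (l.map fun a => t / (t - a)).sum ≤ ((l.filter fun a => a < t).map fun a => t / (t - a)).sum := by
  conv_lhs => rw [← Multiset.filter_add_not (fun a => a < t) l]
  rw [Multiset.map_add, Multiset.sum_add]
  have hneg : ((l.filter fun a => ¬ a < t).map fun a => t / (t - a)).sum ≤ 0 := by
    refine spikeSum_nonpos_of_lt _ ht fun a ha => ?_
    rw [Multiset.mem_filter] at ha
    exact lt_of_le_of_ne (not_lt.mp ha.2) (hlt a ha.1).symm
  linarith

/-- **curvature of a cluster of spikes** (Cauchy–Schwarz): for `t > 0` off `l` (all `a ∈ l` positive), with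
`g₊ = Σ_{a < t} t/(t − a)` and `k = #{a ∈ l : a < t}`:  `g₊²/k − g₊ ≤ Σ_{a ∈ l} a·t/(t − a)²`
(each spike below `t` contributes `x(x − 1)` with `x = t/(t − a)`, those above contribute `≥ 0`). [folklore] -/
theorem spike_curvature (l : Multiset ℝ) {t : ℝ} (ht : 0 < t) (hl : ∀ a ∈ l, 0 < a) (hlt : ∀ a ∈ l, a ≠ t) :
    ((l.filter fun a => a < t).map fun a => t / (t - a)).sum ^ 2 / Multiset.card (l.filter fun a => a < t) -
        ((l.filter fun a => a < t).map fun a => t / (t - a)).sum ≤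
      -(t * (l.map fun a => -a / (t - a) ^ 2).sum) := by
  set lp := l.filter fun a => a < t with hlp
  set gp := (lp.map fun a => t / (t - a)).sum with hgp
  -- the full second-order sum dominates its part below `t`
  have hall : (lp.map fun a => a * t / (t - a) ^ 2).sum ≤ (l.map fun a => a * t / (t - a) ^ 2).sum := by
    conv_rhs => rw [← Multiset.filter_add_not (fun a => a < t) l]
    rw [Multiset.map_add, Multiset.sum_add]
    have : 0 ≤ ((l.filter fun a => ¬ a < t).map fun a => a * t / (t - a) ^ 2).sum :=
      Multiset.sum_nonneg fun x hx => by
        obtain ⟨a, ha, rfl⟩ := Multiset.mem_map.mp hx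
        exact div_nonneg (mul_nonneg (hl a (Multiset.mem_filter.mp ha).1).le ht.le) (sq_nonneg _)
    linarith
  have hrw : -(t * (l.map fun a => -a / (t - a) ^ 2).sum) = (l.map fun a => a * t / (t - a) ^ 2).sum := by
    rw [← Multiset.sum_map_mul_left, ← Multiset.sum_map_neg]
    exact congrArg _ (Multiset.map_congr rfl fun a _ => by ring)
  -- below `t`: `a t/(t−a)² = x² − x` with `x = t/(t−a)`
  have hsq : (lp.map fun a => a * t / (t - a) ^ 2).sum =
      (lp.map fun a => (t / (t - a)) ^ 2).sum - gp := by
    rw [hgp, ← Multiset.sum_map_sub]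
    refine congrArg _ (Multiset.map_congr rfl fun a ha => ?_)
    have hne : t - a ≠ 0 := sub_ne_zero.mpr (hlt a (Multiset.mem_filter.mp ha).1).symm
    field_simp
    ring
  -- Cauchy–Schwarz on the multiset of spike values
  have hcs := sq_sum_le_card_mul_sum_sq_multiset (lp.map fun a => t / (t - a))
  rw [Multiset.card_map, Multiset.map_map] at hcs
  have hcs' : gp ^ 2 ≤ Multiset.card lp * (lp.map fun a => (t / (t - a)) ^ 2).sum := by
    simpa [Function.comp_def, hgp] using hcs
  rw [hrw]
  have hdiv : gp ^ 2 / Multiset.card lp ≤ (lp.map fun a => (t / (t - a)) ^ 2).sum := by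
    rcases Nat.eq_zero_or_pos (Multiset.card lp) with h0 | hpos
    · rw [h0, Nat.cast_zero, div_zero]
      exact Multiset.sum_nonneg fun x hx => by
        obtain ⟨a, -, rfl⟩ := Multiset.mem_map.mp hx
        exact sq_nonneg _
    · rw [div_le_iff₀ (by exact_mod_cast hpos)]
      linarith
  linarith

end Spikes

/-! ## §3 No two zeros of the potential on a root-free stretch (abstract Rolle step) -/

section NoTwoZeros

/-- **abstract one-crossing lemma.**  On `[x, y]` let `Φ` and `g` be differentiable, `g′ ≤ 0`, and `Φ′ < 0` wherever `g ≥ L`.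
If `g(y) ≥ L` then `Φ` cannot vanish at both ends. [folklore] -/
theorem potential_no_two_zeros {x y L : ℝ} (hxy : x < y) {Φ g Φ' g' : ℝ → ℝ}
    (hΦ : ∀ t ∈ Set.Icc x y, HasDerivAt Φ (Φ' t) t) (hg : ∀ t ∈ Set.Icc x y, HasDerivAt g (g' t) t)
    (hg' : ∀ t ∈ Set.Icc x y, g' t ≤ 0) (hΦ' : ∀ t ∈ Set.Icc x y, L ≤ g t → Φ' t < 0)
    (hgy : L ≤ g y) (hx0 : Φ x = 0) (hy0 : Φ y = 0) : False := by
  have hganti : AntitoneOn g (Set.Icc x y) := by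
    refine antitoneOn_of_deriv_nonpos (convex_Icc x y) ?_ ?_ ?_
    · exact fun t ht => (hg t ht).continuousAt.continuousWithinAt
    · rw [interior_Icc]
      exact fun t ht => (hg t (Set.Ioo_subset_Icc_self ht)).differentiableAt.differentiableWithinAt
    · rw [interior_Icc]
      intro t ht
      rw [(hg t (Set.Ioo_subset_Icc_self ht)).deriv]
      exact hg' t (Set.Ioo_subset_Icc_self ht)
  have hgL : ∀ t ∈ Set.Icc x y, L ≤ g t := fun t ht =>
    hgy.trans (hganti ht (Set.right_mem_Icc.mpr hxy.le) ht.2)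
  have hΦanti : StrictAntiOn Φ (Set.Icc x y) := by
    refine strictAntiOn_of_deriv_neg (convex_Icc x y) ?_ ?_
    · exact fun t ht => (hΦ t ht).continuousAt.continuousWithinAt
    · rw [interior_Icc]
      intro t ht
      rw [(hΦ t (Set.Ioo_subset_Icc_self ht)).deriv]
      exact hΦ' t (Set.Ioo_subset_Icc_self ht) (hgL t (Set.Ioo_subset_Icc_self ht))
  have := hΦanti (Set.left_mem_Icc.mpr hxy.le) (Set.right_mem_Icc.mpr hxy.le) hxy
  rw [hx0, hy0] at this
  exact lt_irrefl _ this

end NoTwoZeros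

/-! ## §4 The arithmetic of the transition zone -/

section Arith

/-- **transition-zone inequality**: with `D·s ≥ 4n`, `1 ≤ k ≤ n`, `g₊ ≥ D − n/s` and the Cauchy–Schwarz curvature bound
`g₊²/k − g₊ ≤ R`, the spike curvature `R` beats the off-sector drift `n/s²`. [folklore] -/
theorem transition_zone_arith {n D s gp R k : ℝ} (hs : 0 < s) (hs1 : s ≤ 1) (hn : 1 ≤ n) (hk1 : 1 ≤ k) (hkn : k ≤ n)
    (hdeg : 4 * n ≤ s * D) (hgp : D - n / s ≤ gp) (hR : gp ^ 2 / k - gp ≤ R) : n / s ^ 2 < R := by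
  have hD : 0 < D := by nlinarith
  have h1 : n / s ≤ D / 4 := by rw [div_le_iff₀ hs]; linarith
  have hns : n ≤ n / s := by
    rw [le_div_iff₀ hs]; nlinarith
  have h2 : 3 * D / 4 ≤ gp := by linarith
  have h3 : D / 2 ≤ gp - n := by linarith
  have hgp0 : 0 ≤ gp := by linarith
  have h4 : 3 * D / 4 * (D / 2) ≤ gp * (gp - n) := mul_le_mul h2 h3 (by linarith) hgp0
  -- `R + gp ≥ gp²/k ≥ gp²/n`
  have hk0 : 0 < k := by linarith
  have h5 : gp ^ 2 / n ≤ R + gp := by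
    have : gp ^ 2 / n ≤ gp ^ 2 / k := div_le_div_of_nonneg_left (sq_nonneg gp) hk0 hkn
    linarith
  have h6 : gp * (gp - n) / n ≤ R := by
    have : gp * (gp - n) / n = gp ^ 2 / n - gp := by
      have hn0 : n ≠ 0 := by linarith
      field_simp
    rw [this]; linarith
  -- `n/s² < (3D/4)(D/2)/n` since `D² s² ≥ 16 n²`
  have h7 : (4 * n) ^ 2 ≤ (s * D) ^ 2 := pow_le_pow_left₀ (by linarith) hdeg 2
  have h8 : n / s ^ 2 < 3 * D / 4 * (D / 2) / n := by
    rw [div_lt_div_iff₀ (by positivity) (by linarith)]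
    nlinarith
  calc n / s ^ 2 < 3 * D / 4 * (D / 2) / n := h8
    _ ≤ gp * (gp - n) / n := div_le_div_of_nonneg_right h4 (by linarith)
    _ ≤ R := h6

end Arith

end Summit.ValiantsHypothesis.ValiantsHypothesis.Theorems.KPlusLogSqLaw.TowerGraft
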